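import Literature.AnabelianGeometry.EtaleTheta.TemperedFrobenioidOfRankOneBase
import Literature.AnabelianGeometry.EtaleTheta.RealificationPfImageWeak
import Literature.AlgebraicGeometry.Frobenioids.RealSpanKernel
import HarnessLib

/-!
# [EtTh] Def. 3.6 (ii): a tempered Frobenioid of monoid type `ℤ` over ANY weak Def. 3.6 (i) data `ofRlfZWeak dm hpf`, along
# ANY base functor whose `Φ₀`-values carry ℕ-COORDINATES with a DIAGONAL — generic HIGHER-RANK NV engine (class (b))

S. Mochizuki, *The étale theta function …*, Publ. RIMS **45** (2009) [MochizukiEtTh2009], Def. 3.3 (iii) p.73, Prop. 3.2 (i) p.70,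
Def. 3.6 (i)(ii) p.76–77 [cite: MochizukiEtTh2009, Def 3.6 p.77]; [FrdI] Def. 1.1 (i)(ii) p.19, Def. 2.4 (i) p.47, Prop. 5.3, Thm. 5.2 (ii).

abc-iut cell, layer L2 [EtTh], seat abc-iut-w5-d179 (gen 6), L2-lead row R505 «ℤ-TOWER TEMPERED FROBENIOID OVER THE FULL TEMPERED
BASE», FILE 2 of 3.  abc-iut-w6-d048's `TemperedFrobenioid.ofRankOneBase` (p452350) builds Def. 3.6 (ii) data along a base functor
`F : D ⥤ D₀` whose `Φ₀`-values are RANK ONE (`Φ₀(F A) ≅ ℤ_{≥0}`, every effective log-divisor the divisor of a constant) — there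
Def. 3.6 (ii)(a) degenerates to `Φ^{bs-fld} = Φ`.  THIS FILE is the same construction for `Φ₀`-values of ARBITRARY RANK:
* `TemperedFrobenioid.DiagonalBase dm D` — the data: `F : D ⥤ D₀`; at every `A`, a family of ℕ-valued COORDINATES
  `κ_i : Φ₀(F A) →* ℤ_{≥0}` (the multiplicities along the Galois orbits of irreducible components, Rmk. 3.3.1) and a DIAGONAL
  `d_A ∈ Φ₀(F A)` (the reduced special fibre `= div(ϖ)`) with `κ_i(d_A) = 1`, "all coordinates equal to `c` ⇒ `= d_A^c`", every
  constant's divisor a power of `[d_A]` and `[d_A]` the divisor of some constant (`Φ₀^cnst(F A) = ⟨[d_A]⟩`, Def. 3.3 (iii)), and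
  the pull-backs of `Φ₀` along `F`-images injective and divisibility-reflecting;
* `DiagonalBase.pfImage A := im(Φ₀(F A)^pf → Φ₀(F A)^rlf)` (print's `Φ`), `DiagonalBase.diagImage A := ι(⟨d_A⟩^pf)`, and
  **`pfImage_inf_cnstR_eq : Φ(A) ∩ ℝ·Φ₀^cnst = ι(⟨d_A⟩^pf)`** — `⊆`: the span `ℝ·[d_A]` is killed by the `ℝ`-linear functionals
  `κ_i^rlf / κ_{i₀}^rlf` (`RlfUniversalWeak.existsUnique_map`, `IsPerfFactorialWeak.Rlf.map_realSMul`, `RealificationData.realSpan_le_ker`;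
  abc-iut-L2-d2's `WeakPiNat.mem_diagImage_of_mem_cnstR` argument made generic); `⊇`: root-closure of `ℝ·Φ₀^cnst`;
* **`TemperedFrobenioid.ofDiagonalBase hpf P hD hD' hFSM R S : TemperedFrobenioid (ofRlfZWeak dm hpf) D (treeCatVocab D R S)`**
  with `base := P.F` — EVERY Def. 3.6 (ii) condition PROVED: `Φ(A)` group-saturated, weakly perf-factorial with cofinal
  perfection, divisorial monoid on `D`, **(a) `Φ^{bs-fld}(A) = ι(⟨d_A⟩^pf) ≅ ℚ_{≥0}` monoprime — a PROPER submonoid of `Φ(A)`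
  whenever `Φ₀(F A)` has rank `> 1`**, (b) `div(ϖ) = ι(d_A)/1 ≠ 1`;
* for §4: `ofDiagonalBase_isPerfect` (`hP`), `isNonDilating_ofDiagonalBase_of_trivial`, `isFrobenioid_ofDiagonalBase` ([FrdI] 5.2 (ii)).
Class (b): 1 structure `DiagonalBase` + 4 defs (`pfImage`, `diagImage`, `Φsub`, `ofDiagonalBase`) + theorems; universe of the
`Φ₀`-values fixed to `0` (coordinates in `Multiplicative ℕ`); no Prop-valued fact, no instance, no notation, no sorry.  HONEST
FRAMING: class (b) construction over interface records; nothing here bears on [IUTchIII] Cor. 3.12; typed ≠ proved.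
-/

noncomputable section

namespace Literature.AnabelianGeometry.EtaleTheta

open CategoryTheory Opposite Function Literature.AlgebraicGeometry.Frobenioids

universe u₀ v₀ u v

namespace TemperedFrobenioid

/-- **Diagonal base data** for Def. 3.3 (iii) data `dm` over `D₀` and a base category `D`: a functor `F : D ⥤ D₀`; at every
`A`, ℕ-valued coordinates `κ_i : Φ₀(F A) →* ℤ_{≥0}` (multiplicities along the Galois orbits of components, Rmk. 3.3.1) with a
distinguished index `i₀`, and a diagonal `d_A ∈ Φ₀(F A)` (the reduced special fibre) of coordinates `1` such that an element all
of whose coordinates equal `c` is `d_A^c`; the constants have divisors in `⟨[d_A]⟩` and `[d_A]` is the divisor of a constant;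
the pull-backs of `Φ₀` along `F`-images are injective and reflect divisibility. [cite: MochizukiEtTh2009, Def 3.6 p.77] -/
structure DiagonalBase {D₀ : Type u₀} [Category.{v₀} D₀] (dm : DivisorMonoids.{u₀, v₀, 0} D₀)
    (D : Type u) [Category.{v} D] : Type (max u₀ v₀ u v 1) where
  /-- the base functor `D → D₀` -/
  F : D ⥤ D₀
  /-- the index set of the coordinates of `Φ₀(F A)` -/
  I : D → Type
  /-- a distinguished coordinate index -/
  i₀ : ∀ A : D, I A
  /-- the coordinates `Φ₀(F A) → ℤ_{≥0}` -/
  κ : ∀ A : D, I A → ((dm.Φ₀.obj (op (F.obj A)) : Type) →* Multiplicative ℕ)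
  /-- the diagonal `d_A ∈ Φ₀(F A)` (the reduced special fibre) -/
  d : ∀ A : D, (dm.Φ₀.obj (op (F.obj A)) : Type)
  /-- every coordinate of the diagonal is `1` -/
  κ_d : ∀ (A : D) (i : I A), κ A i (d A) = Multiplicative.ofAdd 1
  /-- an element all of whose coordinates equal `c` is `d_A^c` -/
  eq_pow_of_κ_eq : ∀ (A : D) (m : (dm.Φ₀.obj (op (F.obj A)) : Type)) (c : ℕ),
    (∀ i : I A, κ A i m = Multiplicative.ofAdd c) → m = d A ^ c
  /-- the divisor of every constant function is a power of `[d_A]` -/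
  div₀_mem_zpowers : ∀ (A : D) (b : (dm.B₀.obj (op (F.obj A)) : Type)), b ∈ dm.F₀ (op (F.obj A)) →
    dm.div₀ _ b ∈ Subgroup.zpowers (Algebra.GrothendieckGroup.of (d A))
  /-- `[d_A]` is the divisor of some constant function (`ϖ`) -/
  exists_div₀_eq : ∀ A : D, ∃ b ∈ dm.F₀ (op (F.obj A)), dm.div₀ _ b = Algebra.GrothendieckGroup.of (d A)
  /-- pull-backs of `Φ₀` along `F`-images are injective -/
  hΦinj : ∀ {A B : D} (f : A ⟶ B), Injective (dm.Φ₀.map (F.map f).op).hom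
  /-- pull-backs of `Φ₀` along `F`-images reflect divisibility -/
  hΦrefl : ∀ {A B : D} (f : A ⟶ B) (a b : dm.Φ₀.obj (op (F.obj B))),
    (dm.Φ₀.map (F.map f).op).hom a ∣ (dm.Φ₀.map (F.map f).op).hom b → a ∣ b

namespace DiagonalBase

variable {D₀ : Type u₀} [Category.{v₀} D₀] {dm : DivisorMonoids.{u₀, v₀, 0} D₀}
  (hpf : ∀ Y : D₀ᵒᵖ, IsPerfFactorialCof (dm.Φ₀.obj Y)) {D : Type u} [Category.{v} D] (P : DiagonalBase dm D)

/-- `d_A ≠ 1` (its coordinates are `1`). [cite: MochizukiEtTh2009, Prop 3.2 p.70] -/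
theorem d_ne_one (A : D) : P.d A ≠ 1 := fun h => by
  have h2 := P.κ_d A (P.i₀ A)
  rw [h, map_one] at h2
  exact one_ne_zero (ofAdd_eq_one.mp h2.symm)

/-- **An element of `Φ₀(F A)^pf` all of whose coordinates agree is (a root of) a power of the diagonal**: it lies in the image
of `⟨d_A⟩^pf → Φ₀(F A)^pf`. [cite: MochizukiEtTh2009, Prop 3.2 p.70] -/
theorem mem_mrange_map_powersHom_of_forall_eq (A : D) (a : Perfection (dm.Φ₀.obj (op (P.F.obj A))))
    (h : ∀ i : P.I A, Perfection.map (P.κ A i) a = Perfection.map (P.κ A (P.i₀ A)) a) :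
    a ∈ MonoidHom.mrange (Perfection.map (powersHom (dm.Φ₀.obj (op (P.F.obj A))) (P.d A))) := by
  obtain ⟨⟨m, n⟩, rfl⟩ := Perfection.mk_surjective a
  -- every coordinate of `m` equals its `i₀`-th coordinate
  have hcoord : ∀ i : P.I A, P.κ A i m = P.κ A (P.i₀ A) m := by
    intro i
    have hi := h i
    simp only [Perfection.map_mk] at hi
    obtain ⟨N, hN⟩ := Perfection.mk_eq_mk_iff.mp hi
    have hN' := congrArg Multiplicative.toAdd hN
    simp only [toAdd_pow, smul_eq_mul] at hN'
    exact Multiplicative.toAdd.injective (Nat.eq_of_mul_eq_mul_left (Nat.mul_pos N.pos n.pos) hN')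
  have hm : m = P.d A ^ Multiplicative.toAdd (P.κ A (P.i₀ A) m) :=
    P.eq_pow_of_κ_eq A m _ fun i => by rw [hcoord i, ofAdd_toAdd]
  refine ⟨Perfection.mk (Multiplicative.ofAdd (Multiplicative.toAdd (P.κ A (P.i₀ A) m))) n, ?_⟩
  rw [Perfection.map_mk, powersHom_apply, toAdd_ofAdd, ← hm]

/-- `⟨d_A⟩^pf → Φ₀(F A)^pf` is injective (read at the coordinate `i₀`). [cite: MochizukiEtTh2009, Prop 3.2 p.70] -/
theorem map_powersHom_injective (A : D) :
    Injective (Perfection.map (powersHom (dm.Φ₀.obj (op (P.F.obj A))) (P.d A))) := by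
  intro x y hxy
  obtain ⟨⟨c, n⟩, rfl⟩ := Perfection.mk_surjective x
  obtain ⟨⟨c', n'⟩, rfl⟩ := Perfection.mk_surjective y
  simp only [Perfection.map_mk, powersHom_apply] at hxy
  obtain ⟨N, hN⟩ := Perfection.mk_eq_mk_iff.mp hxy
  -- read the relation at the coordinate `i₀`
  have hN' := congrArg (fun m => Multiplicative.toAdd (P.κ A (P.i₀ A) m)) hN
  simp only [← pow_mul, map_pow, P.κ_d, toAdd_pow, toAdd_ofAdd, smul_eq_mul, mul_one] at hN'
  change Perfection.mk c n = Perfection.mk c' n'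
  refine Perfection.mk_eq_mk_iff.mpr ⟨N, ?_⟩
  apply Multiplicative.toAdd.injective
  simp only [toAdd_pow, smul_eq_mul]
  -- `hN'` : toAdd c * (N * n') = toAdd c' * (N * n)
  rw [mul_comm, hN', mul_comm]

/-- `ι(d_A) ≠ 1` in `Φ₀^ℝ(F A)` (`Φ₀^pf ↪ Φ₀^rlf`, `Φ₀` sharp). [cite: MochizukiEtTh2009, Def 3.6 p.77] -/
theorem toRealification_d_ne_one (A : D) :
    (hpf (op (P.F.obj A))).weak.toRealification (Perfection.of _ (P.d A)) ≠ 1 := by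
  intro h
  have h1 := PfImageWeak.toRealification_injective (hpf (op (P.F.obj A))).weak (h.trans (map_one _).symm)
  rw [Perfection.of_apply, Perfection.mk_eq_one_iff_of_isSharp (hpf _).weak.isDivisorial.isSharp] at h1
  exact P.d_ne_one A h1

/-- `Φ(A) := im(Φ₀(F A)^pf → Φ₀(F A)^rlf)` (weak realification map; print's `Φ`). [cite: MochizukiEtTh2009, Def 3.6 p.76] -/
def pfImage (A : Dᵒᵖ) : Submonoid ((RealifiedDivisorMonoids.ofRlfZWeak dm hpf).ΦR.obj (op (P.F.obj A.unop))) :=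
  MonoidHom.mrange (hpf (op (P.F.obj A.unop))).weak.toRealification

/-- The diagonal image `ι(⟨d_A⟩^pf) ⊆ Φ(A)`: the classes of the roots `(d_A^c)^{1/n}` — it will be `Φ^{bs-fld}(A)`.
[cite: MochizukiEtTh2009, Def 3.6 p.77] -/
def diagImage (A : Dᵒᵖ) : Submonoid ((RealifiedDivisorMonoids.ofRlfZWeak dm hpf).ΦR.obj (op (P.F.obj A.unop))) :=
  MonoidHom.mrange ((hpf (op (P.F.obj A.unop))).weak.toRealification.comp
    (Perfection.map (powersHom (dm.Φ₀.obj (op (P.F.obj A.unop))) (P.d A.unop))))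

/-- `ι(⟨d⟩^pf) ⊆ Φ`. [cite: MochizukiEtTh2009, Def 3.6 p.77] -/
theorem diagImage_le_pfImage (A : Dᵒᵖ) : P.diagImage hpf A ≤ P.pfImage hpf A := by
  rintro _ ⟨a, rfl⟩
  exact ⟨_, rfl⟩

/-- `ι(⟨d⟩^pf)` is monoprime (`≅ (ℤ_{≥0})^pf ≅ ℚ_{≥0}`). [cite: MochizukiEtTh2009, Def 3.6 p.77] -/
theorem isMonoprime_diagImage (A : Dᵒᵖ) : IsMonoprime ↥(P.diagImage hpf A) := by
  have hinj : Injective ((hpf (op (P.F.obj A.unop))).weak.toRealification.comp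
      (Perfection.map (powersHom (dm.Φ₀.obj (op (P.F.obj A.unop))) (P.d A.unop)))) :=
    (PfImageWeak.toRealification_injective (hpf _).weak).comp (P.map_powersHom_injective A.unop)
  exact IsMonoprime.of_mulEquiv
    (MulEquiv.ofBijective _ ⟨fun _ _ h => hinj (congrArg Subtype.val h), MonoidHom.mrangeRestrict_surjective _⟩)
    (PerfectionPrimes.isMonoprime_perfection isMonoprime_multiplicative_nat)

/-- `ι^gp([d_A]^k) = [ι(d_A)]^k` in `(Φ₀^ℝ)^gp` (THE weak realification data: `ι^gp = gpMap (Φ₀ → Φ₀^rlf)`).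
[cite: MochizukiEtTh2009, Def 3.6 p.76] -/
theorem toRlfGp_of_d_zpow (A : D) (k : ℤ) :
    ((RealifiedDivisorMonoids.realDataWeak dm hpf).toRlfGp (P.F.obj A) (Algebra.GrothendieckGroup.of (P.d A) ^ k) :
        Algebra.GrothendieckGroup (hpf (op (P.F.obj A))).weak.Rlf) =
      (Algebra.GrothendieckGroup.of ((hpf (op (P.F.obj A))).weak.toRealification (Perfection.of _ (P.d A))) :
        Algebra.GrothendieckGroup (hpf (op (P.F.obj A))).weak.Rlf) ^ k := by
  rw [map_zpow,
    show ((RealifiedDivisorMonoids.realDataWeak dm hpf).toRlfGp (P.F.obj A) (Algebra.GrothendieckGroup.of (P.d A)) :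
        Algebra.GrothendieckGroup (hpf (op (P.F.obj A))).weak.Rlf) =
      (Algebra.GrothendieckGroup.of ((hpf (op (P.F.obj A))).weak.toRealification (Perfection.of _ (P.d A))) :
        Algebra.GrothendieckGroup (hpf (op (P.F.obj A))).weak.Rlf) from MonGp.map_of _ _]
  rfl

/-- **`ι(⟨d⟩^pf) ⊆ ℝ·Φ₀^cnst`**: `[ι((d^c)^{1/n})]^n = [ι(d^c)] = ι^gp([d]^c) ∈ ℝ·Φ₀^cnst` (`[d]` is the divisor of a constant,
`Φ₀^cnst ⊆ ℝ·Φ₀^cnst`), and `ℝ·Φ₀^cnst` is root-closed. [cite: MochizukiEtTh2009, Def 3.6 p.76] -/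
theorem of_mem_cnstR_of_mem_diagImage (A : Dᵒᵖ) {x : (RealifiedDivisorMonoids.ofRlfZWeak dm hpf).ΦR.obj (op (P.F.obj A.unop))}
    (hx : x ∈ P.diagImage hpf A) :
    Algebra.GrothendieckGroup.of x ∈ (RealifiedDivisorMonoids.ofRlfZWeak dm hpf).cnstR (op (P.F.obj A.unop)) := by
  obtain ⟨a, rfl⟩ := hx
  obtain ⟨⟨c, n⟩, rfl⟩ := Perfection.mk_surjective a
  have hM := hpf (op (P.F.obj A.unop))
  refine (RealifiedDivisorMonoids.ofRlfZWeak dm hpf).cnstR_root _ _ n ?_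
  -- `[ι(d^c)] = ι^gp(div₀(b^c)) ∈ ℝ·Φ₀^cnst` since `Φ₀^cnst ⊆ ℝ·Φ₀^cnst`
  obtain ⟨b, hb, hbd⟩ := P.exists_div₀_eq A.unop
  have key := (RealifiedDivisorMonoids.ofRlfZWeak dm hpf).cnst_le_cnstR (op (P.F.obj A.unop)) (b ^ Multiplicative.toAdd c)
    (pow_mem hb _)
  have hb' : dm.div₀ (op (P.F.obj A.unop)) (b ^ Multiplicative.toAdd c) =
      Algebra.GrothendieckGroup.of (P.d A.unop ^ Multiplicative.toAdd c) := by
    rw [map_pow, hbd, map_pow]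
  change EtaleTheta.gpMap _ (dm.div₀ (op (P.F.obj A.unop)) (b ^ Multiplicative.toAdd c)) ∈ _ at key
  rw [hb'] at key
  -- the `n`-th power of the class of `ι((d^c)^{1/n})` is `[ι(d^c)]`
  have e : Algebra.GrothendieckGroup.of ((hM.weak.toRealification.comp
      (Perfection.map (powersHom _ (P.d A.unop)))) (Perfection.mk c n)) ^ (n : ℕ) =
      EtaleTheta.gpMap ((RealifiedDivisorMonoids.ofRlfZWeak dm hpf).toR (op (P.F.obj A.unop)))
        (Algebra.GrothendieckGroup.of (P.d A.unop ^ Multiplicative.toAdd c)) := by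
    rw [← map_pow, ← map_pow, Perfection.mk_pow_self, EtaleTheta.gpMap_of]
    rfl
  exact (congrArg (· ∈ (RealifiedDivisorMonoids.ofRlfZWeak dm hpf).cnstR (op (P.F.obj A.unop))) e).mpr key

/-! ### The realified coordinates and `Φ ∩ ℝ·Φ₀^cnst ⊆ ι(⟨d⟩^pf)` -/

/-- **The realified coordinate `κ_i^rlf : Φ₀(F A)^rlf → (ℤ_{≥0})^rlf`** over `κ_i^pf` (weak universal property of the
realification, [FrdI] Prop. 5.3). [cite: MochizukiFrdI2008, Prop. 5.3 p.103] -/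
theorem exists_coordRlf (A : D) (i : P.I A) :
    ∃ χ : (hpf (op (P.F.obj A))).weak.Rlf →* PiNatRlfWeak.natWeak.Rlf,
      χ.comp (hpf (op (P.F.obj A))).weak.toRealification =
        PiNatRlfWeak.natWeak.toRealification.comp (Perfection.map (P.κ A i)) :=
  (RlfUniversalWeak.existsUnique_map (hpf _).weak (hpf _).rlfCofinal PiNatRlfWeak.natWeak
    PiNatRlfWeak.natWeak.supports_rlf_R _).exists

/-- The realified coordinate on the image of `Φ₀^pf`. [cite: MochizukiFrdI2008, Prop. 5.3 p.103] -/
theorem coordRlf_apply {A : D} {i : P.I A} {χ : (hpf (op (P.F.obj A))).weak.Rlf →* PiNatRlfWeak.natWeak.Rlf}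
    (hχ : χ.comp (hpf (op (P.F.obj A))).weak.toRealification =
      PiNatRlfWeak.natWeak.toRealification.comp (Perfection.map (P.κ A i)))
    (a : Perfection (dm.Φ₀.obj (op (P.F.obj A)))) :
    χ ((hpf (op (P.F.obj A))).weak.toRealification a) = PiNatRlfWeak.natWeak.toRealification (Perfection.map (P.κ A i) a) := by
  have h := DFunLike.congr_fun hχ a
  rwa [MonoidHom.comp_apply, MonoidHom.comp_apply] at h

/-- **`Φ ∩ ℝ·Φ₀^cnst ⊆ ι(⟨d⟩^pf)`**: if `ι(a) ∈ Φ(A)` lies in the `ℝ`-span `ℝ·[d_A]`, then all coordinates of `a` agree — the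
span is killed by the `ℝ`-linear functionals `κ_i^rlf / κ_{i₀}^rlf` on `(Φ₀^rlf)^gp`, which kill `[d_A]` and hence `Φ₀^cnst ⊆
⟨[d_A]⟩` (`RealificationData.realSpan_le_ker`, `IsPerfFactorialWeak.Rlf.map_realSMul`) — so `a ∈ ⟨d_A⟩^pf`.
[cite: MochizukiEtTh2009, Def 3.6 p.77] -/
theorem mem_diagImage_of_mem_cnstR (A : Dᵒᵖ) {x : (RealifiedDivisorMonoids.ofRlfZWeak dm hpf).ΦR.obj (op (P.F.obj A.unop))}
    (hx : x ∈ P.pfImage hpf A)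
    (hc : Algebra.GrothendieckGroup.of x ∈ (RealifiedDivisorMonoids.ofRlfZWeak dm hpf).cnstR (op (P.F.obj A.unop))) :
    x ∈ P.diagImage hpf A := by
  obtain ⟨a, rfl⟩ := hx
  have hM := hpf (op (P.F.obj A.unop))
  -- all coordinates of `a` agree with the `i₀`-th one
  have hcoord : ∀ i : P.I A.unop,
      Perfection.map (P.κ A.unop i) a = Perfection.map (P.κ A.unop (P.i₀ A.unop)) a := by
    intro i
    obtain ⟨χ, hχ⟩ := P.exists_coordRlf hpf A.unop i
    obtain ⟨χ₀, hχ₀⟩ := P.exists_coordRlf hpf A.unop (P.i₀ A.unop)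
    -- the `ℝ`-linear functional `Dg := κ_i^rlf / κ_{i₀}^rlf` on `(Φ₀^rlf)^gp`
    let Dg : Algebra.GrothendieckGroup hM.weak.Rlf →* Algebra.GrothendieckGroup PiNatRlfWeak.natWeak.Rlf :=
      MonGp.map χ / MonGp.map χ₀
    have hDg : ∀ ξ, Dg ξ = MonGp.map χ ξ / MonGp.map χ₀ ξ := fun _ => rfl
    -- `Dg` kills the image of `d`: `κ_i(d) = 1 = κ_{i₀}(d)`
    have hDd : Dg (Algebra.GrothendieckGroup.of (hM.weak.toRealification (Perfection.of _ (P.d A.unop)))) = 1 := by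
      rw [hDg, MonGp.map_of, MonGp.map_of, P.coordRlf_apply hpf hχ, P.coordRlf_apply hpf hχ₀, Perfection.of_apply,
        Perfection.map_mk, Perfection.map_mk, P.κ_d, P.κ_d, div_self']
    have hle : (RealifiedDivisorMonoids.ofRlfZWeak dm hpf).cnstR (op (P.F.obj A.unop)) ≤ Dg.ker := by
      rw [RealifiedDivisorMonoids.ofRlfZWeak_cnstR]
      apply RealificationData.realSpan_le_ker
      · -- the kernel is stable under the scalars `r • (−)` (`ℝ`-linearity of `κ^rlf`)
        change ∀ (r : ℝ) (ξ : Algebra.GrothendieckGroup hM.weak.Rlf), Dg ξ = 1 →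
          Dg (IsPerfFactorialWeak.Rlf.realSMul hM.weak r ξ) = 1
        intro r ξ hξ
        rw [hDg, div_eq_one] at hξ
        rw [hDg, IsPerfFactorialWeak.Rlf.map_realSMul, IsPerfFactorialWeak.Rlf.map_realSMul, hξ, div_self']
      · -- `Dg` kills `ι^gp(Φ₀^cnst)`: `Φ₀^cnst ⊆ ⟨[d]⟩` and `ι^gp([d]^k) = [ι(d)]^k`
        let ιgp : Algebra.GrothendieckGroup (dm.Φ₀.obj (op (P.F.obj A.unop))) →* Algebra.GrothendieckGroup hM.weak.Rlf :=
          (RealifiedDivisorMonoids.realDataWeak dm hpf).toRlfGp (P.F.obj A.unop)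
        change ∀ c, c ∈ dm.cnstGp.carrier (P.F.obj A.unop) → (Dg.comp ιgp) c = 1
        intro c hc
        have hsub : (↑(dm.cnst (op (P.F.obj A.unop))) : Set (Algebra.GrothendieckGroup (dm.Φ₀.obj (op (P.F.obj A.unop))))) ⊆
            ↑(Dg.comp ιgp).ker := by
          rintro _ ⟨b, hb, rfl⟩
          obtain ⟨k, hk⟩ := Subgroup.mem_zpowers_iff.mp (P.div₀_mem_zpowers A.unop b hb)
          change Dg (ιgp (dm.div₀ _ b)) = 1
          rw [← hk, show ιgp (Algebra.GrothendieckGroup.of (P.d A.unop) ^ k) = _ from P.toRlfGp_of_d_zpow hpf A.unop k,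
            map_zpow, hDd, one_zpow]
        exact (Subgroup.closure_le _).mpr hsub hc
    have h1 : Dg (Algebra.GrothendieckGroup.of (hM.weak.toRealification a)) = 1 := hle hc
    rw [hDg, div_eq_one, MonGp.map_of, MonGp.map_of] at h1
    haveI := IsPerfFactorialWeak.Rlf.isCancelMul PiNatRlfWeak.natWeak
    have h2 := Algebra.GrothendieckGroup.of_injective h1
    rw [P.coordRlf_apply hpf hχ, P.coordRlf_apply hpf hχ₀] at h2
    exact PfImageWeak.toRealification_injective _ h2
  obtain ⟨b, hb⟩ := P.mem_mrange_map_powersHom_of_forall_eq A.unop a hcoord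
  exact ⟨b, congrArg hM.weak.toRealification hb⟩

/-- **`Φ(A) ∩ ℝ·Φ₀^cnst(F A) = ι(⟨d_A⟩^pf)`** ("`Φ^{bs-fld}(A)`"). [cite: MochizukiEtTh2009, Def 3.6 p.77] -/
theorem pfImage_inf_cnstR_eq (A : Dᵒᵖ) :
    P.pfImage hpf A ⊓ ((RealifiedDivisorMonoids.ofRlfZWeak dm hpf).cnstR (op (P.F.obj A.unop))).toSubmonoid.comap
      Algebra.GrothendieckGroup.of = P.diagImage hpf A :=
  le_antisymm (fun _ hx => P.mem_diagImage_of_mem_cnstR hpf A hx.1 hx.2)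
    fun _ hx => ⟨P.diagImage_le_pfImage hpf A hx, P.of_mem_cnstR_of_mem_diagImage hpf A hx⟩

/-! ### `Φ` as a subfunctor in monoids along `F` -/

/-- **`Φ ⊆ Φ^{ℝ-log} := Φ₀^ℝ|_D` as a subfunctor in monoids along `F`.** [cite: MochizukiEtTh2009, Def 3.6 p.76] -/
def Φsub : SubMonoidOn (P.F.op ⋙ (RealifiedDivisorMonoids.ofRlfZWeak dm hpf).ΦR) where
  carrier A := P.pfImage hpf A
  map_mem := by
    rintro A B f _ ⟨a, rfl⟩
    exact ⟨Literature.AlgebraicGeometry.Frobenioids.Perfection.map (dm.Φ₀.map (P.F.map f.unop).op).hom a,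
      (DFunLike.congr_fun (rlfMapWeak_comp_toRealification dm.Φ₀ hpf (P.F.map f.unop).op) a).symm⟩

/-- The carrier of `Φsub` at `A` is `Φ(A)`. [cite: MochizukiEtTh2009, Def 3.6 p.76] -/
@[simp] theorem Φsub_carrier (A : Dᵒᵖ) : (P.Φsub hpf).carrier A = P.pfImage hpf A := rfl

/-- **The pull-backs of `Φ` are injective** (abc-iut-w6-d048's `rlfMapWeak_injective_of_reflects`).
[cite: MochizukiFrdI2008, Def. 1.1 (ii) p.19] -/
theorem Φsub_pull_injective {A B : Dᵒᵖ} (f : A ⟶ B) : Injective ((P.Φsub hpf).pull f) := by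
  intro x y h
  apply Subtype.ext
  have h' := congrArg Subtype.val h
  exact rlfMapWeak_injective_of_reflects dm.Φ₀ hpf (P.F.map f.unop).op (P.hΦinj f.unop) (P.hΦrefl f.unop) h'

/-- **The pull-back of `Φ` along an endomorphism `φ` pulling `Φ₀(F A)` back IDENTICALLY is the identity.**
[cite: MochizukiFrdI2008, Def. 1.1 (i) p.19] -/
theorem Φsub_pull_apply_of_trivial {A : Dᵒᵖ} (φ : A ⟶ A)
    (hid : ∀ m : dm.Φ₀.obj (op (P.F.obj A.unop)), (dm.Φ₀.map (P.F.map φ.unop).op).hom m = m)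
    (x : (P.Φsub hpf).carrier A) : (P.Φsub hpf).pull φ x = x := by
  apply Subtype.ext
  obtain ⟨a, ha⟩ := x.2
  obtain ⟨⟨m, n⟩, rfl⟩ := Perfection.mk_surjective a
  rw [SubMonoidOn.coe_pull]
  change rlfMapWeak dm.Φ₀ hpf (P.F.map φ.unop).op x.1 = x.1
  rw [← ha]
  have h := DFunLike.congr_fun (rlfMapWeak_comp_toRealification dm.Φ₀ hpf (P.F.map φ.unop).op) (Perfection.mk m n)
  rw [MonoidHom.comp_apply, MonoidHom.comp_apply, Literature.AlgebraicGeometry.Frobenioids.Perfection.map_mk, hid] at h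
  exact h

end DiagonalBase

section Engine

variable {D₀ : Type u₀} [Category.{v₀} D₀] {dm : DivisorMonoids.{u₀, v₀, 0} D₀}
  (hpf : ∀ Y : D₀ᵒᵖ, IsPerfFactorialCof (dm.Φ₀.obj Y)) {D : Type u} [Category.{v} D] (P : DiagonalBase dm D)
  (hD : IsConnected D) (hD' : IsTotallyEpimorphic D) (hFSM : IsOfFSMType D) (R S : (Dᵒᵖ ⥤ CommMonCat.{0}) → Prop)

include hFSM in
/-- **Def. 3.6 (ii) data of monoid type `ℤ` over the weak Def. 3.6 (i) data `ofRlfZWeak dm hpf`, ALONG THE BASE FUNCTOR `P.F` of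
diagonal base data** (`D` connected, totally epimorphic, of FSM-type): `Φ := im(Φ₀^pf → Φ₀^rlf)` objectwise along `F`; every
condition PROVED — in particular (a) `Φ^{bs-fld}(A) = ι(⟨d_A⟩^pf)` monoprime (a PROPER submonoid of `Φ(A)` in rank `> 1`) and
(b) `div(ϖ) = ι(d_A)/1 ≠ 1`. [cite: MochizukiEtTh2009, Def 3.6 p.77] -/
def ofDiagonalBase : TemperedFrobenioid (RealifiedDivisorMonoids.ofRlfZWeak dm hpf) D (treeCatVocab D R S) where
  isConnected := hD
  isTotallyEpimorphic := hD'
  base := P.F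
  Φ := P.Φsub hpf
  isGroupSaturated A := PfImageWeak.isGroupSaturated_mrange_toRealification (hpf (op (P.F.obj A.unop))).weak
  isPerfFactorial A := PfImageWeak.isPerfFactorialCof_mrange_toRealification (hpf (op (P.F.obj A.unop)))
  isDivisorialOn := by
    rw [treeCatVocab_isDivisorialOn]
    refine ⟨⟨fun f => isCharInjective_of_injective_of_isSharp _ (P.Φsub_pull_injective hpf f.op)
      (PfImageWeak.isDivisorial_mrange_toRealification (hpf _)).isSharp, fun f hf => ?_⟩,
      fun A => PfImageWeak.isDivisorial_mrange_toRealification (hpf (op (P.F.obj A)))⟩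
    exact (fun _ : IsIso f => PreFrobenioid.RatFrac.pull_bijective_of_isIso f) (hFSM.isIso_of_isFSM f hf)
  isMonoprime_bsFld A :=
    IsMonoprime.of_mulEquiv (MulEquiv.submonoidCongr (P.pfImage_inf_cnstR_eq hpf A).symm) (P.isMonoprime_diagImage hpf A)
  exists_FΛ_div_ne A := by
    obtain ⟨b, hb, hbd⟩ := P.exists_div₀_eq A.unop
    refine ⟨b, hb, (hpf (op (P.F.obj A.unop))).weak.toRealification (Perfection.of _ (P.d A.unop)), ⟨_, rfl⟩, 1, one_mem _,
      P.toRealification_d_ne_one hpf A.unop, ?_⟩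
    simp only [map_one, div_one]
    rw [RealifiedDivisorMonoids.ofRlfZWeak_divΛ_apply]
    change EtaleTheta.gpMap _ (dm.div₀ (op (P.F.obj A.unop)) b) = _
    rw [hbd]
    exact EtaleTheta.gpMap_of _ _

/-- `Φ(A)` of the engine is `im(Φ₀(F A)^pf → Φ₀(F A)^rlf)`. [cite: MochizukiEtTh2009, Def 3.6 p.77] -/
@[simp] theorem ofDiagonalBase_Φ_carrier (A : Dᵒᵖ) :
    (ofDiagonalBase hpf P hD hD' hFSM R S).Φ.carrier A = P.pfImage hpf A := rfl

/-- The base functor of the engine is `P.F`. [cite: MochizukiEtTh2009, Def 3.6 p.77] -/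
@[simp] theorem ofDiagonalBase_base : (ofDiagonalBase hpf P hD hD' hFSM R S).base = P.F := rfl

/-- **`Φ^{bs-fld}(A)` of the engine is the diagonal image `ι(⟨d_A⟩^pf)`** — Def. 3.6 (ii)(a) with content.
[cite: MochizukiEtTh2009, Def 3.6 p.77] -/
theorem ofDiagonalBase_bsFld_carrier (A : Dᵒᵖ) :
    (ofDiagonalBase hpf P hD hD' hFSM R S).bsFld.carrier A = P.diagImage hpf A :=
  P.pfImage_inf_cnstR_eq hpf A

/-- **`Φ(A)` is perfect** (the image of the perfection `Φ₀(F A)^pf`; the `hP` slot of the §4 setting).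
[cite: MochizukiEtTh2009, Def 4.1 p.86] -/
theorem ofDiagonalBase_isPerfect (A : Dᵒᵖ) : IsPerfect ((ofDiagonalBase hpf P hD hD' hFSM R S).Φ.carrier A) :=
  IsPerfect.of_mulEquiv (MulEquiv.ofBijective _ (PfImageWeak.mrangeRestrict_toRealification_bijective (hpf _).weak))
    isPerfect_perfection

/-- **`Φ` is non-dilating along every endomorphism pulling `Φ₀` back identically.** [cite: MochizukiFrdI2008, Def. 1.1 (i) p.19] -/
theorem isNonDilating_ofDiagonalBase_of_trivial (A : Dᵒᵖ) (φ : A ⟶ A)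
    (hid : ∀ m : dm.Φ₀.obj (op (P.F.obj A.unop)), (dm.Φ₀.map (P.F.map φ.unop).op).hom m = m) :
    treeMonoidVocabWeak.{0}.IsNonDilating ((ofDiagonalBase hpf P hD hD' hFSM R S).Φ.carrier A)
      ((ofDiagonalBase hpf P hD hD' hFSM R S).Φ.pull φ) :=
  isNonDilating_of_apply_eq _ (P.Φsub_pull_apply_of_trivial hpf φ hid)

/-- **The engine's tempered Frobenioid IS a Frobenioid** ([FrdI] Thm. 5.2 (ii); abc-iut-L2-t3's `isFrobenioid_of_isOfFSMType`,
`hBinj` from the injectivity of the `B₀`-pull-backs). [cite: MochizukiFrdI2008, Thm. 5.2 (ii) p.100] -/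
theorem isFrobenioid_ofDiagonalBase (hB₀inj : ∀ {Y Y' : D₀ᵒᵖ} (g : Y ⟶ Y'), Injective (dm.B₀.map g).hom) :
    PreFrobenioid.IsFrobenioid (ofDiagonalBase hpf P hD hD' hFSM R S).toElem :=
  (ofDiagonalBase hpf P hD hD' hFSM R S).isFrobenioid_of_isOfFSMType
    (RealifiedDivisorMonoids.ofRlfZWeak_hBinj dm hpf hB₀inj) hFSM

end Engine

end TemperedFrobenioid

end Literature.AnabelianGeometry.EtaleTheta

end
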